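import Summits.AtomisticToContinuum.FouriersLaw.Theorems.BoundaryEscapeDeficitHalfChainLocalityWindowMarginal
import Summits.AtomisticToContinuum.FouriersLaw.Theorems.BoundaryEscapeDeficitHalfChainLocalityTransferGap

/-!
# Uniform bound and large-`n` limit of the boundary-window densities `D_{n,ℓ}`

Helper file (`--supports stmt-AtomisticToContinuum-12240`, item `HalfChainLocality` of route
`BoundaryEscapeDeficit`, sub-problem `FouriersLaw`). By `gibbsMeasure_map_take`
(`…HalfChainLocalityWindowMarginal`) the law of the first `ℓ+1` sites under the Gibbs measure of the
`(n+1)`-chain is the `(ℓ+1)`-chain Gibbs measure weighted by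
`D_{n,ℓ}(q_ℓ,p_ℓ) = Z_{ℓ+1} Z_{n+1}⁻¹ (κ^[n-ℓ] 1)(q_ℓ,p_ℓ)`. Feeding the one-site a priori measure
`ρ = e^{-(p²/2+U(q))/T} dq dp` and the bond kernel `k(z,z') = e^{-V(z'.1-z.1)/T}` (bounded by `1`,
symmetric for even `V`, strictly positive, continuous) into the abstract Jentzsch-gap asymptotics
`exists_kernelIterate_asymptotics` (`…HalfChainLocalityTransferGap`) gives:

* `exists_pos_lower_bound_of_tendsto` — a positive sequence with a positive limit is bounded below
  by a positive constant;
* `transferIterate_one_pos` — `κ_ℝ^[m] 1 > 0` everywhere, so `Z_{n+1} = ofReal ζ_n` with `ζ_n > 0`;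
* `exists_windowDensity_bound_and_limit` (**main**) — there is `D* > 0` with `D_{n,ℓ} ≤ D*` for ALL
  `ℓ ≤ n` and all boundary points, and for every fixed `ℓ` the real densities `D_{n,ℓ}` converge as
  `n → ∞`, UNIFORMLY in the boundary point (geometric rate from the spectral gap).

All folklore (transfer-operator treatment of one-dimensional Gibbs states, Georgii 2011 §11.1;
Cassandro–Olivieri–Pellegrinotti–Presutti 1978 for unbounded spins); no definitions.
-/

noncomputable section

open MeasureTheory Set Function Filter Topology
open scoped ENNReal

namespace Summit.AtomisticToContinuum.FouriersLaw.Theorems.HalfChainLocality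

open Literature.MathematicalPhysics.KineticTheory.HeatConduction

/-! ### A positive convergent sequence with positive limit is bounded away from zero -/

/-- A positive real sequence converging to a positive limit is bounded below by a positive constant.
[folklore] -/
theorem exists_pos_lower_bound_of_tendsto {r : ℕ → ℝ} {L : ℝ} (hL : 0 < L) (hr : ∀ n, 0 < r n)
    (h : Tendsto r atTop (𝓝 L)) : ∃ c : ℝ, 0 < c ∧ ∀ n, c ≤ r n := by
  obtain ⟨N₁, hN₁⟩ := eventually_atTop.1 (h.eventually (Ici_mem_nhds (half_lt_self hL)))
  -- minimum over the finitely many initial terms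
  have hfin : ∀ K : ℕ, ∃ c₀ : ℝ, 0 < c₀ ∧ ∀ n, n < K → c₀ ≤ r n := by
    intro K
    induction K with
    | zero => exact ⟨1, one_pos, fun n hn => absurd hn (Nat.not_lt_zero n)⟩
    | succ N ih =>
      obtain ⟨c₀, hc₀, hc⟩ := ih
      refine ⟨min c₀ (r N), lt_min hc₀ (hr N), fun n hn => ?_⟩
      rcases Nat.lt_succ_iff_lt_or_eq.1 hn with h' | rfl
      · exact (min_le_left _ _).trans (hc n h')
      · exact min_le_right _ _
  obtain ⟨c₀, hc₀, hc⟩ := hfin N₁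
  refine ⟨min c₀ (L / 2), lt_min hc₀ (half_pos hL), fun n => ?_⟩
  rcases Nat.lt_or_ge n N₁ with hn | hn
  · exact (min_le_left _ _).trans (hc n hn)
  · exact (min_le_right _ _).trans (hN₁ n hn)

variable (P : OscillatorChain) (T : ℝ)

set_option quotPrecheck false

/-- The one-site a priori measure `ρ = e^{-(p²/2 + U(q))/T} dq dp` on `ℝ × ℝ`. -/
local notation "ρT" => (volume.withDensity fun z : ℝ × ℝ =>
  ENNReal.ofReal (Real.exp (-(z.2 ^ 2 / 2 + P.U z.1) / T)) : Measure (ℝ × ℝ))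

/-- The lintegral transfer step. -/
local notation "κT" => (fun g : ℝ × ℝ → ℝ≥0∞ => fun z : ℝ × ℝ =>
  ∫⁻ z', ENNReal.ofReal (Real.exp (-P.V (z'.1 - z.1) / T)) * g z' ∂ρT)

/-- The real (Bochner) transfer step. -/
local notation "κR" => (fun f : ℝ × ℝ → ℝ => fun z : ℝ × ℝ =>
  ∫ z', Real.exp (-P.V (z'.1 - z.1) / T) * f z' ∂ρT)

/-! ### The one-site measure and positivity of the transfer iterates -/

/-- The one-site a priori measure is nonzero (its density is everywhere positive). [folklore] -/
theorem siteMeasure_ne_zero (hUc : Continuous P.U) : (ρT) ≠ 0 := by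
  intro h
  have h1 : (ρT) univ = 0 := by rw [h]; rfl
  rw [withDensity_apply _ MeasurableSet.univ, Measure.restrict_univ] at h1
  have hpos : 0 < ∫⁻ z : ℝ × ℝ, ENNReal.ofReal (Real.exp (-(z.2 ^ 2 / 2 + P.U z.1) / T)) := by
    rw [lintegral_pos_iff_support (measurable_siteWeight P hUc.measurable T)]
    have : Function.support (fun z : ℝ × ℝ => ENNReal.ofReal (Real.exp (-(z.2 ^ 2 / 2 + P.U z.1) / T))) = univ := by
      ext z; simp [Real.exp_pos]
    rw [this]
    simp
  exact hpos.ne' h1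

/-- **`κ_ℝ^[m] 1 > 0` everywhere** (integral of an everywhere positive integrable function against a
nonzero measure). [folklore] -/
theorem transferIterate_one_pos (hUc : Continuous P.U) (hVc : Continuous P.V) (hV0 : ∀ r, 0 ≤ P.V r)
    (hT : 0 ≤ T) (hfin : IsFiniteMeasure ρT) (m : ℕ) (z : ℝ × ℝ) : 0 < (κR^[m] 1) z := by
  induction m generalizing z with
  | zero => simp
  | succ m ih =>
    obtain ⟨-, hb, hmeas⟩ := transferIterate_one_eq_ofReal P T hVc hV0 hT hfin m
    rw [Function.iterate_succ_apply']
    have hk : Measurable fun z' : ℝ × ℝ => Real.exp (-P.V (z'.1 - z.1) / T) :=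
      ((hVc.measurable.comp (measurable_fst.sub measurable_const)).neg.div_const T).exp
    have hint : Integrable (fun z' => Real.exp (-P.V (z'.1 - z.1) / T) * (κR^[m] 1) z') ρT := by
      refine Integrable.mono' (integrable_const (((ρT).real univ) ^ m))
        (hk.mul hmeas).aestronglyMeasurable (Eventually.of_forall fun z' => ?_)
      rw [Real.norm_eq_abs, abs_mul, abs_of_pos (Real.exp_pos _), abs_of_nonneg (hb z').1]
      calc Real.exp (-P.V (z'.1 - z.1) / T) * (κR^[m] 1) z' ≤ 1 * ((ρT).real univ) ^ m :=
            mul_le_mul (bondFactor_pos_le_one P T hV0 hT _).2 (hb z').2 (hb z').1 zero_le_one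
        _ = ((ρT).real univ) ^ m := one_mul _
    rw [integral_pos_iff_support_of_nonneg_ae (Eventually.of_forall fun z' =>
      mul_nonneg (Real.exp_nonneg _) (hb z').1) hint]
    have hsupp : Function.support (fun z' => Real.exp (-P.V (z'.1 - z.1) / T) * (κR^[m] 1) z') = univ := by
      ext z'
      simp only [Function.mem_support, ne_eq, mem_univ, iff_true]
      exact (mul_pos (Real.exp_pos _) (ih z')).ne'
    rw [hsupp]
    exact pos_iff_ne_zero.2 fun h => siteMeasure_ne_zero P T hUc (Measure.measure_univ_eq_zero.1 h)

/-- **The partition function is `ofReal` of the (positive, finite) real transfer integral**: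
`Z_{n+1} = ofReal ζ_n`, `ζ_n = ∫ κ_ℝ^[n] 1 dρ > 0`. [folklore] -/
theorem partitionFunction_succ_eq_ofReal (hUc : Continuous P.U) (hVc : Continuous P.V)
    (hV0 : ∀ r, 0 ≤ P.V r) (hT : 0 ≤ T) (hfin : IsFiniteMeasure ρT) (n : ℕ) :
    P.partitionFunction (n + 1) T = ENNReal.ofReal (∫ z, (κR^[n] 1) z ∂ρT) ∧
      0 < ∫ z, (κR^[n] 1) z ∂ρT ∧ Integrable (κR^[n] 1) ρT := by
  haveI := hfin
  obtain ⟨he, hb, hmeas⟩ := transferIterate_one_eq_ofReal P T hVc hV0 hT hfin n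
  have hint : Integrable (κR^[n] 1) ρT := by
    refine Integrable.mono' (integrable_const (((ρT).real univ) ^ n)) hmeas.aestronglyMeasurable
      (Eventually.of_forall fun z => ?_)
    rw [Real.norm_eq_abs, abs_of_nonneg (hb z).1]
    exact (hb z).2
  refine ⟨?_, ?_, hint⟩
  · rw [partitionFunction_succ_eq_lintegral_transferIterate P hUc.measurable hVc.measurable T n,
      ofReal_integral_eq_lintegral_ofReal hint (Eventually.of_forall fun z => (hb z).1)]
    exact lintegral_congr fun z => he z
  · rw [integral_pos_iff_support_of_nonneg_ae (Eventually.of_forall fun z => (hb z).1) hint]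
    have hsupp : Function.support (κR^[n] 1) = univ := by
      ext z
      simp only [Function.mem_support, ne_eq, mem_univ, iff_true]
      exact (transferIterate_one_pos P T hUc hVc hV0 hT hfin n z).ne'
    rw [hsupp]
    exact pos_iff_ne_zero.2 fun h => siteMeasure_ne_zero P T hUc (Measure.measure_univ_eq_zero.1 h)

/-! ### The uniform bound and the limit -/

/-- **Uniform bound and large-`n` limit of the window densities.** For continuous `U`, continuous even
`V ≥ 0`, `T > 0` and a finite one-site measure `ρ`: there is `D* > 0` such that
(a) `Z_{ℓ+1} Z_{n+1}⁻¹ (κ^[n-ℓ] 1)(z) ≤ D*` for all `ℓ ≤ n` and all `z`;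
(b) for every `ℓ` there is `d_∞ : ℝ × ℝ → ℝ` with
`sup_z |(Z_{ℓ+1} Z_{n+1}⁻¹ (κ^[n-ℓ] 1)(z)).toReal - d_∞(z)| → 0` as `n → ∞`.
Mechanism: `κ_ℝ^[m] 1/λ^m → ψ ∫φ₀/λ` uniformly and `ζ_n/λⁿ → (∫φ₀)² > 0` geometrically
(Jentzsch's gap for the compact positivity-improving transfer operator on `L²(ρ)`). [folklore] -/
theorem exists_windowDensity_bound_and_limit (hUc : Continuous P.U) (hVc : Continuous P.V)
    (hV0 : ∀ r, 0 ≤ P.V r) (hVsymm : ∀ r, P.V (-r) = P.V r) (hT : 0 < T) (hfin : IsFiniteMeasure ρT) :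
    ∃ Dstar : ℝ, 0 < Dstar ∧
      (∀ n ℓ : ℕ, ℓ ≤ n → ∀ z : ℝ × ℝ,
        P.partitionFunction (ℓ + 1) T * (P.partitionFunction (n + 1) T)⁻¹ * (κT^[n - ℓ] 1) z ≤
          ENNReal.ofReal Dstar) ∧
      (∀ ℓ : ℕ, ∃ dinf : ℝ × ℝ → ℝ, ∀ ε : ℝ, 0 < ε → ∃ N₀ : ℕ, ℓ ≤ N₀ ∧ ∀ n : ℕ, N₀ ≤ n → ∀ z : ℝ × ℝ,
        |(P.partitionFunction (ℓ + 1) T * (P.partitionFunction (n + 1) T)⁻¹ * (κT^[n - ℓ] 1) z).toReal -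
            dinf z| ≤ ε) := by
  haveI := hfin
  have hT0 : 0 ≤ T := hT.le
  -- the abstract package for the kernel `k(z, z') = e^{-V(z'.1 - z.1)/T}` on `L²(ρ)`
  have hK : StronglyMeasurable (uncurry fun z z' : ℝ × ℝ => Real.exp (-P.V (z'.1 - z.1) / T)) := by
    refine Continuous.stronglyMeasurable ?_
    exact ((hVc.comp (continuous_snd.fst.sub continuous_fst.fst)).neg.div_const T).rexp
  have hC : ∀ z z' : ℝ × ℝ, ‖Real.exp (-P.V (z'.1 - z.1) / T)‖ ≤ 1 := fun z z' => by
    rw [Real.norm_eq_abs, abs_of_pos (Real.exp_pos _)]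
    exact (bondFactor_pos_le_one P T hV0 hT0 _).2
  have hsymm : ∀ z z' : ℝ × ℝ, Real.exp (-P.V (z'.1 - z.1) / T) = Real.exp (-P.V (z.1 - z'.1) / T) := by
    intro z z'
    rw [← hVsymm (z.1 - z'.1), neg_sub]
  have hpos : ∀ z z' : ℝ × ℝ, 0 < Real.exp (-P.V (z'.1 - z.1) / T) := fun z z' => Real.exp_pos _
  obtain ⟨lam, θ, φ₀, hlam, hθ0, hθ, -, -, -, -, -, hc₁, hψpos, hψb, hi, hii⟩ :=
    exists_kernelIterate_asymptotics (μ := ρT) hK hC hsymm hpos (siteMeasure_ne_zero P T hUc)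
  -- abbreviations (as local hypotheses, beta-reduced)
  set c₁ : ℝ := ∫ z, φ₀ z ∂ρT with hc₁def
  set ψ : ℝ × ℝ → ℝ := fun z => ∫ z', Real.exp (-P.V (z'.1 - z.1) / T) * φ₀ z' ∂ρT with hψdef
  set M : ℝ := (ρT).real univ with hMdef
  set ζ : ℕ → ℝ := fun n => ∫ z, (κR^[n] 1) z ∂ρT with hζdef
  have hM0 : 0 ≤ M := measureReal_nonneg
  set q : ℝ := θ / lam with hqdef
  have hq0 : 0 ≤ q := div_nonneg hθ0 hlam.le
  have hq1 : q < 1 := (div_lt_one hlam).2 hθ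
  -- (ii) with `g = h = 1`: `|ζ_n - λⁿ c₁²| ≤ M θⁿ`
  have hζ : ∀ n, |ζ n - lam ^ n * c₁ * c₁| ≤ M * θ ^ n := by
    intro n
    have h := hii 1 1 measurable_one measurable_one 1 1 (fun _ => by simp) (fun _ => by simp) n
    simp only [Pi.one_apply, one_mul, mul_one] at h
    exact h
  -- (i) with `h = 1`: `|κ_ℝ^[j+1] 1 (z) - λ^j ψ(z) c₁| ≤ M θ^j`
  have ha : ∀ (j : ℕ) (z : ℝ × ℝ), |(κR^[j + 1] 1) z - lam ^ j * ψ z * c₁| ≤ M * θ ^ j := by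
    intro j z
    have h := hi 1 measurable_one 1 (fun _ => by simp) j z
    simp only [Pi.one_apply, mul_one, one_mul] at h
    exact h
  -- positivity of `ζ`
  have hζpos : ∀ n, 0 < ζ n := fun n => (partitionFunction_succ_eq_ofReal P T hUc hVc hV0 hT0 hfin n).2.1
  -- `r_n = ζ_n / λⁿ → c₁² > 0`, bounded below by `rinf > 0` and above by `c₁² + M`
  set r : ℕ → ℝ := fun n => ζ n / lam ^ n with hrdef
  have hrpos : ∀ n, 0 < r n := fun n => div_pos (hζpos n) (pow_pos hlam n)
  have hr_sub : ∀ n, |r n - c₁ * c₁| ≤ M * q ^ n := by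
    intro n
    have hln : 0 < lam ^ n := pow_pos hlam n
    have e : r n - c₁ * c₁ = (ζ n - lam ^ n * c₁ * c₁) / lam ^ n := by
      rw [hrdef]; field_simp
    rw [e, abs_div, abs_of_pos hln, div_le_iff₀ hln]
    calc |ζ n - lam ^ n * c₁ * c₁| ≤ M * θ ^ n := hζ n
      _ = M * q ^ n * lam ^ n := by
          rw [hqdef, div_pow]; field_simp
  have hr_tend : Tendsto r atTop (𝓝 (c₁ * c₁)) := by
    have h0 : Tendsto (fun n => M * q ^ n) atTop (𝓝 0) := by
      simpa using (tendsto_pow_atTop_nhds_zero_of_lt_one hq0 hq1).const_mul M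
    rw [tendsto_iff_norm_sub_tendsto_zero]
    exact squeeze_zero (fun n => norm_nonneg _) (fun n => by rw [Real.norm_eq_abs]; exact hr_sub n) h0
  have hcc : 0 < c₁ * c₁ := mul_pos hc₁ hc₁
  obtain ⟨rinf, hrinf0, hrinf⟩ := exists_pos_lower_bound_of_tendsto hcc hrpos hr_tend
  have hrsup : ∀ n, r n ≤ c₁ * c₁ + M := fun n => by
    have h1 := (abs_le.1 (hr_sub n)).2
    have h2 : M * q ^ n ≤ M := by
      calc M * q ^ n ≤ M * 1 := mul_le_mul_of_nonneg_left (pow_le_one₀ hq0 hq1.le) hM0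
        _ = M := mul_one M
    linarith
  -- `a_m(z) = κ_ℝ^[m] 1 (z) / λ^m ≤ Astar`
  set Ψ : ℝ := 1 * Real.sqrt M with hΨdef
  have hψle : ∀ z, |ψ z| ≤ Ψ := fun z => hψb z
  set Astar : ℝ := 1 + (Ψ * c₁ + M) / lam with hAdef
  have hA0 : 0 < Astar := by
    have : 0 ≤ (Ψ * c₁ + M) / lam := by positivity
    linarith
  have ha_le : ∀ (m : ℕ) (z : ℝ × ℝ), (κR^[m] 1) z / lam ^ m ≤ Astar := by
    intro m z
    rcases m with _ | j
    · simp only [Function.iterate_zero, id_eq, Pi.one_apply, pow_zero, div_one, hAdef]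
      have : 0 ≤ (Ψ * c₁ + M) / lam := by positivity
      linarith
    · have hlj : 0 < lam ^ (j + 1) := pow_pos hlam _
      have h1 := (abs_le.1 (ha j z)).2
      have hψz := (abs_le.1 (hψle z)).2
      rw [div_le_iff₀ hlj, hAdef]
      have e : (1 + (Ψ * c₁ + M) / lam) * lam ^ (j + 1) = lam ^ (j + 1) + (Ψ * c₁ + M) * lam ^ j := by
        rw [pow_succ]; field_simp
      rw [e]
      have h2 : lam ^ j * ψ z * c₁ ≤ Ψ * c₁ * lam ^ j := by
        have := mul_le_mul_of_nonneg_right hψz (mul_nonneg (pow_pos hlam j).le hc₁.le)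
        nlinarith
      have h3 : M * θ ^ j ≤ M * lam ^ j :=
        mul_le_mul_of_nonneg_left (pow_le_pow_left₀ hθ0 hθ.le j) hM0
      nlinarith [pow_pos hlam (j + 1)]
  have ha_nn : ∀ (m : ℕ) (z : ℝ × ℝ), 0 ≤ (κR^[m] 1) z / lam ^ m := fun m z =>
    div_nonneg (transferIterate_one_pos P T hUc hVc hV0 hT0 hfin m z).le (pow_pos hlam m).le
  -- the density in real terms
  have hD : ∀ n ℓ : ℕ, ℓ ≤ n → ∀ z : ℝ × ℝ,
      P.partitionFunction (ℓ + 1) T * (P.partitionFunction (n + 1) T)⁻¹ * (κT^[n - ℓ] 1) z =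
        ENNReal.ofReal ((κR^[n - ℓ] 1) z / lam ^ (n - ℓ) * r ℓ / r n) := by
    intro n ℓ hℓ z
    obtain ⟨hZℓ, -, -⟩ := partitionFunction_succ_eq_ofReal P T hUc hVc hV0 hT0 hfin ℓ
    obtain ⟨hZn, -, -⟩ := partitionFunction_succ_eq_ofReal P T hUc hVc hV0 hT0 hfin n
    obtain ⟨he, -, -⟩ := transferIterate_one_eq_ofReal P T hVc hV0 hT0 hfin (n - ℓ)
    rw [hZℓ, hZn, he z, ← ENNReal.ofReal_inv_of_pos (hζpos n), ← ENNReal.ofReal_mul (hζpos ℓ).le,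
      ← ENNReal.ofReal_mul (mul_nonneg (hζpos ℓ).le (inv_pos.2 (hζpos n)).le)]
    congr 1
    have hln : lam ^ n = lam ^ (n - ℓ) * lam ^ ℓ := by rw [← pow_add, Nat.sub_add_cancel hℓ]
    change ζ ℓ * (ζ n)⁻¹ * (κR^[n - ℓ] 1) z = (κR^[n - ℓ] 1) z / lam ^ (n - ℓ) * (ζ ℓ / lam ^ ℓ) / (ζ n / lam ^ n)
    rw [hln]
    field_simp
  refine ⟨Astar * (c₁ * c₁ + M) / rinf, by positivity, ?_, ?_⟩
  · -- (a) the uniform bound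
    intro n ℓ hℓ z
    rw [hD n ℓ hℓ z]
    refine ENNReal.ofReal_le_ofReal ?_
    rw [div_le_div_iff₀ (hrpos n) hrinf0]
    calc (κR^[n - ℓ] 1) z / lam ^ (n - ℓ) * r ℓ * rinf ≤ Astar * (c₁ * c₁ + M) * r n := by
          have h1 := ha_le (n - ℓ) z
          have h2 := hrsup ℓ
          have h3 := hrinf n
          have h4 := ha_nn (n - ℓ) z
          have h5 := (hrpos ℓ).le
          calc (κR^[n - ℓ] 1) z / lam ^ (n - ℓ) * r ℓ * rinf ≤ Astar * (c₁ * c₁ + M) * rinf := by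
                gcongr
            _ ≤ Astar * (c₁ * c₁ + M) * r n := by gcongr
      _ = Astar * (c₁ * c₁ + M) * r n := rfl
  · -- (b) the uniform-in-`z` limit as `n → ∞`
    intro ℓ
    refine ⟨fun z => ψ z * c₁ / lam * r ℓ / (c₁ * c₁), fun ε hε => ?_⟩
    -- explicit `z`-free bound tending to `0`
    set b : ℕ → ℝ := fun n => r ℓ * (M * q ^ (n - ℓ - 1) / lam / rinf +
        Astar * (M * q ^ n) / (rinf * (c₁ * c₁))) with hbdef
    have hb_tend : Tendsto b atTop (𝓝 0) := by
      have hqn : Tendsto (fun n : ℕ => q ^ n) atTop (𝓝 0) := tendsto_pow_atTop_nhds_zero_of_lt_one hq0 hq1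
      have hqn' : Tendsto (fun n : ℕ => q ^ (n - ℓ - 1)) atTop (𝓝 0) := by
        refine (hqn.comp (tendsto_sub_atTop_nat 1)).comp (tendsto_sub_atTop_nat ℓ) |>.congr fun n => ?_
        simp [Function.comp]
      have h1 : Tendsto (fun n => M * q ^ (n - ℓ - 1) / lam / rinf) atTop (𝓝 0) := by
        simpa using ((hqn'.const_mul M).div_const lam).div_const rinf
      have h2 : Tendsto (fun n => Astar * (M * q ^ n) / (rinf * (c₁ * c₁))) atTop (𝓝 0) := by
        simpa using ((hqn.const_mul M).const_mul Astar).div_const (rinf * (c₁ * c₁))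
      simpa [hbdef] using (h1.add h2).const_mul (r ℓ)
    obtain ⟨N₁, hN₁⟩ := eventually_atTop.1 (hb_tend.eventually (Iic_mem_nhds hε))
    refine ⟨max N₁ (ℓ + 1), le_trans (Nat.le_succ ℓ) (le_max_right _ _), fun n hn z => ?_⟩
    have hnN : N₁ ≤ n := le_trans (le_max_left _ _) hn
    have hnℓ : ℓ + 1 ≤ n := le_trans (le_max_right _ _) hn
    have hℓn : ℓ ≤ n := le_trans (Nat.le_succ ℓ) hnℓ
    rw [hD n ℓ hℓn z, ENNReal.toReal_ofReal (by
      have := ha_nn (n - ℓ) z; have := (hrpos ℓ).le; have := (hrpos n).le; positivity)]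
    refine le_trans ?_ (hN₁ n hnN)
    -- `|a r_ℓ/r_n - a_∞ r_ℓ/c₁²| ≤ r_ℓ (|a - a_∞|/r_n + a_∞? ...)`: elementary
    obtain ⟨j, hj⟩ : ∃ j, n - ℓ = j + 1 := ⟨n - ℓ - 1, by omega⟩
    have hjn : n - ℓ - 1 = j := by omega
    set a : ℝ := (κR^[n - ℓ] 1) z / lam ^ (n - ℓ) with hadef
    set ainf : ℝ := ψ z * c₁ / lam with hainf
    have ha1 : |a - ainf| ≤ M * q ^ j / lam := by
      have h := ha j z
      rw [hadef, hainf, hj]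
      have hlj : 0 < lam ^ (j + 1) := pow_pos hlam _
      have e : (κR^[j + 1] 1) z / lam ^ (j + 1) - ψ z * c₁ / lam =
          ((κR^[j + 1] 1) z - lam ^ j * ψ z * c₁) / lam ^ (j + 1) := by
        rw [pow_succ]; field_simp
      rw [e, abs_div, abs_of_pos hlj, div_le_div_iff₀ hlj hlam, hqdef, div_pow]
      calc |(κR^[j + 1] 1) z - lam ^ j * ψ z * c₁| * lam ≤ M * θ ^ j * lam :=
            mul_le_mul_of_nonneg_right h hlam.le
        _ = M * (θ ^ j / lam ^ j) * lam ^ (j + 1) := by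
            rw [pow_succ]; field_simp
    have ha2 : |a| ≤ Astar := by
      rw [abs_of_nonneg (ha_nn (n - ℓ) z)]; exact ha_le (n - ℓ) z
    have hr1 : |1 / r n - 1 / (c₁ * c₁)| ≤ M * q ^ n / (rinf * (c₁ * c₁)) := by
      have hrn := hrpos n
      have e : 1 / r n - 1 / (c₁ * c₁) = (c₁ * c₁ - r n) / (r n * (c₁ * c₁)) := by
        field_simp
      rw [e, abs_div, abs_of_pos (mul_pos hrn hcc), abs_sub_comm]
      calc |r n - c₁ * c₁| / (r n * (c₁ * c₁)) ≤ M * q ^ n / (r n * (c₁ * c₁)) :=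
            div_le_div_of_nonneg_right (hr_sub n) (mul_pos hrn hcc).le
        _ ≤ M * q ^ n / (rinf * (c₁ * c₁)) := by
            apply div_le_div_of_nonneg_left (by positivity) (mul_pos hrinf0 hcc)
            exact mul_le_mul_of_nonneg_right (hrinf n) hcc.le
    -- combine
    have e : a * r ℓ / r n - ψ z * c₁ / lam * r ℓ / (c₁ * c₁) =
        r ℓ * ((a - ainf) * (1 / r n) + ainf * (1 / r n - 1 / (c₁ * c₁))) := by
      rw [hainf]; ring
    rw [e, abs_mul, abs_of_pos (hrpos ℓ), hbdef]
    dsimp only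
    rw [hjn]
    refine mul_le_mul_of_nonneg_left ?_ (hrpos ℓ).le
    refine (abs_add_le _ _).trans (add_le_add ?_ ?_)
    · rw [abs_mul, abs_of_pos (one_div_pos.2 (hrpos n))]
      calc |a - ainf| * (1 / r n) ≤ (M * q ^ j / lam) * (1 / rinf) := by
            refine mul_le_mul ha1 ?_ (one_div_pos.2 (hrpos n)).le (by positivity)
            exact one_div_le_one_div_of_le hrinf0 (hrinf n)
        _ = M * q ^ j / lam / rinf := by ring
    · rw [abs_mul]
      have hainf_le : |ainf| ≤ Astar := by
        rw [hainf, abs_div, abs_of_pos hlam, abs_mul, abs_of_pos hc₁, hAdef]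
        rw [div_le_iff₀ hlam]
        have := hψle z
        have e2 : (1 + (Ψ * c₁ + M) / lam) * lam = lam + (Ψ * c₁ + M) := by field_simp
        rw [e2]
        nlinarith [abs_nonneg (ψ z)]
      calc |ainf| * |1 / r n - 1 / (c₁ * c₁)| ≤ Astar * (M * q ^ n / (rinf * (c₁ * c₁))) :=
            mul_le_mul hainf_le hr1 (abs_nonneg _) hA0.le
        _ = Astar * (M * q ^ n) / (rinf * (c₁ * c₁)) := by ring

end Summit.AtomisticToContinuum.FouriersLaw.Theorems.HalfChainLocality

end
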